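import Summits.HodgeConjecture.HodgeConjecture.Theorems.GenericDivisibilityGenericDivisibilityBoundedHeartHodgeOfHC
import Summits.HodgeConjecture.HodgeConjecture.Theorems.GenericDivisibilityGenericDivisibilityBoundedHodgeModConiveauStable
import Summits.HodgeConjecture.HodgeConjecture.Theorems.GenericDivisibilityGenericDivisibilityBoundedFunnelOn
import Summits.HodgeConjecture.HodgeConjecture.Theorems.GenericDivisibilityGenericDivisibilityBoundedLevelCleanFunnel
import Summits.HodgeConjecture.HodgeConjecture.Theorems.GenericDivisibilityHodgeBoundedSuffices
import HarnessLib

/-!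
# Line `finite-level-bootstrap` of the crux `GenericDivisibilityBounded` (C2, stmt-HodgeConjecture-18467):
# restricted to classes "Hodge modulo coniveau one", the HEART is exactly as hard as the Hodge conjecture

Route-level record of lead c5 (cycle 7 of the line; assembly of the wave-2 sub-goals p168623, p168784,
p168748; supports stmt-HodgeConjecture-18467). Sorry-free, definition-free: the two `Prop`s involved are
spelled inline.

* `HeartHdg` (the Hodge-restricted heart): on every smooth projective complex `2p`-fold `X`, `p ≥ 2`,
  SOME prime `ℓ` has SOME level `ℓ^s`, `s ≥ 1`, that is clean ON `A(X)` — for every integral class `z`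
  which is *Hodge modulo coniveau one* (`∃ h` rational of Hodge type `(p,p)` with
  `z ⊗ ℂ - h ∈ N¹ = supportedClasses X (2p) 1`), `D'(ℓ^s, z)` (on the complex points of some non-empty
  Zariski open `z| ≡ ℓ^s • y` up to a class killed by some `M ≥ 1`) forces `z - ℓ • w ∈ GT(X)`
  (generically torsion) for some `w`. The line's Hodge-free heart `stub_finiteLevel` is the same
  statement for ALL `z`.
* `C2_Hdg` (the Hodge-restricted crux, as in `genericDivisibility_hodgeConjecture_of_hodgeBounded`,
  p156175): C2 for integral classes whose complexification is of Hodge type `(p,p)`.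

## Main results

* `genericDivisibilityBounded_hodgeBounded_of_heartHdg` — **`HeartHdg ⟹ C2_Hdg`**: the funnel
  "one clean level ⟹ C2 at `X`" RELATIVE to the predicate `A(X)` (`stub_cruxAtOfLevelCleanOn`,
  p168748), which contains the Hodge classes and is stable under the bootstrap step
  (`stub_hodgeModConiveau_of_sub_genericallyTorsion`, p168784); `p = 1` is the landed crux
  `genericDivisibilityBounded_one`.
* `genericDivisibilityBounded_heartHdg_of_hodgeConjecture` — **`HC ⟹ HeartHdg`** (at `ℓ = 2`, `s = 1`,
  and in fact at every `(ℓ, s)`: `stub_levelCleanOnHodgeOfHodgeConjectureFor`, p168623 — under HC every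
  class of `A(X)` is generically torsion).
* `genericDivisibilityBounded_hodgeConjecture_iff_C1_and_heartHdg` — **modulo the route's support item
  `TorsionDiesGenerically` (CT–Voisin 2012 Thm. 3.1), `HC ⟺ C1 ∧ HeartHdg`** (forward direction to C1
  from seat 0's `genericDivisibility_hodgeConjecture_iff_of_torsionDiesGenerically`; backward by
  `genericDivisibility_hodgeConjecture_of_hodgeBounded`).

So the Hodge-restricted heart carries NO risk beyond HC and offers no shortcut to it; the entire surplus
of the line's Hodge-free heart over HC is the non-Hodge phantom question (crux notes HEART-c2 §F, Q1):
can a Hodge–Tate-invisible constituent of `H²ᵖ/N¹` be generically `ℓ`-adically divisible?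

References: [ColliotTheleneVoisin2012] Thm. 3.1, §4.1; [Thomas2005Nodes] Thm. 1; [VoisinHodgeI2002]
§7.1.1, §11.3; [Deligne2000] §1.
-/

-- `Summit.HodgeConjecture.HodgeConjecture.Theorems` is the mandated namespace (single-problem
-- summit: Problem = Summit), which `linter.dupNamespace` flags on every declaration; the lakefile
-- turns the linter off tree-wide (weak option), restated here so stand-alone elaboration is
-- warning-free too.
set_option linter.dupNamespace false

noncomputable section

namespace Summit.HodgeConjecture.HodgeConjecture.Theorems

open CategoryTheory AlgebraicGeometry
open Literature.AlgebraicGeometry.Motives Literature.AlgebraicGeometry.HodgeTheory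
  Literature.AlgebraicTopology.SingularHomology
open Summit.HodgeConjecture.HodgeConjecture.Theses.GenericDivisibility

/-- Restriction `H^k(X(ℂ);ℤ) → H^k((X∖Z)(ℂ);ℤ)`, the very term of the route decls (notation only). -/
local notation3 (prettyPrint := false) "Res[" X ", " Z ", " k "]" =>
  singularCohomology.map ℤ ℤ
    (⟨Subtype.val, continuous_subtype_val⟩ : C(complexPointsCompl X Z, ComplexPoints X)) k

/-- **`HeartHdg ⟹ C2_Hdg`.** If on every smooth projective `2p`-fold (`p ≥ 2`) some prime has a level
clean on the classes that are Hodge modulo coniveau one, then every integral class of Hodge type `(p,p)`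
on a smooth projective `2p`-fold (`p ≥ 1`) which is divisible by every `m ≥ 1` on the complex points of
some non-empty Zariski open has complexification in `N¹`. Proof: for `p = 1` this is the landed crux
`genericDivisibilityBounded_one` (CT–Voisin 2012 §4.1); for `p ≥ 2` run the funnel relative to the
predicate `A(X)` (`stub_cruxAtOfLevelCleanOn`): `A(X)` contains `z` (`h = z ⊗ ℂ`, a rational class:
Voisin I §7.1.1) and is stable under the bootstrap step (`stub_hodgeModConiveau_of_sub_genericallyTorsion`
with multiplier `ℓ^(j+1) ≥ 1`). [cite: ColliotTheleneVoisin2012, §4.1] [cite: VoisinHodgeI2002, §7.1.1] -/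
theorem genericDivisibilityBounded_hodgeBounded_of_heartHdg
    (hH : ∀ ⦃p : ℕ⦄ ⦃X : SchemeOver ℂ⦄, 2 ≤ p → IsSmoothProjective (2 * p) X →
      ∃ ℓ s : ℕ, ℓ.Prime ∧ 1 ≤ s ∧ ∀ z : singularCohomology ℤ ℤ (ComplexPoints X) (2 * p),
        (∃ h : complexBetti X (2 * p), IsRationalClass h ∧ IsOfHodgeType (2 * p) X (2 * p) p p h ∧
          singularCohomology.ringChange (Int.castRingHom ℂ) (ComplexPoints X) (2 * p) z - h ∈
            supportedClasses X (2 * p) 1) →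
        (∃ Z : Set X.left, IsClosed Z ∧ Z ≠ Set.univ ∧
          ∃ (y : singularCohomology ℤ ℤ (complexPointsCompl X Z) (2 * p)) (M : ℕ), 1 ≤ M ∧
            M • (Res[X, Z, 2 * p] z - ℓ ^ s • y) = 0) →
        ∃ w : singularCohomology ℤ ℤ (ComplexPoints X) (2 * p), ∃ Z : Set X.left, IsClosed Z ∧
          Z ≠ Set.univ ∧ ∃ N : ℕ, 1 ≤ N ∧ N • Res[X, Z, 2 * p] (z - ℓ • w) = 0) :
    ∀ ⦃p : ℕ⦄ ⦃X : SchemeOver ℂ⦄, 1 ≤ p → IsSmoothProjective (2 * p) X →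
      ∀ z : singularCohomology ℤ ℤ (ComplexPoints X) (2 * p),
        IsOfHodgeType (2 * p) X (2 * p) p p
          (singularCohomology.ringChange (Int.castRingHom ℂ) (ComplexPoints X) (2 * p) z) →
        (∀ m : ℕ, 1 ≤ m → ∃ Z : Set X.left, IsClosed Z ∧ Z ≠ Set.univ ∧
          ∃ y : singularCohomology ℤ ℤ (complexPointsCompl X Z) (2 * p),
            m • y = Res[X, Z, 2 * p] z) →
        singularCohomology.ringChange (Int.castRingHom ℂ) (ComplexPoints X) (2 * p) z ∈
          supportedClasses X (2 * p) 1 := by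
  intro p X hp hX z hz hdiv
  rcases Nat.lt_or_ge p 2 with hp1 | hp2
  · obtain rfl : p = 1 := by omega
    exact genericDivisibilityBounded_one hX z hdiv
  obtain ⟨ℓ, s, hℓ, hs, hclean⟩ := hH hp2 hX
  refine stub_cruxAtOfLevelCleanOn hX (2 * p) ℓ s hℓ hs
    (fun z ↦ ∃ h : complexBetti X (2 * p), IsRationalClass h ∧ IsOfHodgeType (2 * p) X (2 * p) p p h ∧
      singularCohomology.ringChange (Int.castRingHom ℂ) (ComplexPoints X) (2 * p) z - h ∈
        supportedClasses X (2 * p) 1)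
    (fun z w j hPz hGT ↦ stub_hodgeModConiveau_of_sub_genericallyTorsion hp hX z w (ℓ ^ (j + 1))
      (Nat.one_le_pow _ _ hℓ.pos) hPz hGT)
    (fun z hPz hz' ↦ hclean z hPz hz') z ?_ hdiv
  exact ⟨_, ((isIntegralClass_iff_mem_range_ringChange _).2 ⟨z, rfl⟩).isRationalClass, hz,
    by rw [sub_self]; exact Submodule.zero_mem _⟩

/-- **`HC ⟹ HeartHdg`** (with `ℓ = 2`, `s = 1`; in fact at every `(ℓ, s)`): under the Hodge conjecture
for `X`, every integral class Hodge modulo coniveau one is generically torsion (its rational `(p,p)`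
part is algebraic, `Nᵖ ⊆ N¹`, and `GT = N¹ ∩ H_ℤ`), so `w = 0` serves
(`stub_levelCleanOnHodgeOfHodgeConjectureFor`). [cite: VoisinHodgeI2002, §11.3]
[cite: Deligne2000, §1] -/
theorem genericDivisibilityBounded_heartHdg_of_hodgeConjecture (hHC : _root_.HodgeConjecture) :
    ∀ ⦃p : ℕ⦄ ⦃X : SchemeOver ℂ⦄, 2 ≤ p → IsSmoothProjective (2 * p) X →
      ∃ ℓ s : ℕ, ℓ.Prime ∧ 1 ≤ s ∧ ∀ z : singularCohomology ℤ ℤ (ComplexPoints X) (2 * p),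
        (∃ h : complexBetti X (2 * p), IsRationalClass h ∧ IsOfHodgeType (2 * p) X (2 * p) p p h ∧
          singularCohomology.ringChange (Int.castRingHom ℂ) (ComplexPoints X) (2 * p) z - h ∈
            supportedClasses X (2 * p) 1) →
        (∃ Z : Set X.left, IsClosed Z ∧ Z ≠ Set.univ ∧
          ∃ (y : singularCohomology ℤ ℤ (complexPointsCompl X Z) (2 * p)) (M : ℕ), 1 ≤ M ∧
            M • (Res[X, Z, 2 * p] z - ℓ ^ s • y) = 0) →
        ∃ w : singularCohomology ℤ ℤ (ComplexPoints X) (2 * p), ∃ Z : Set X.left, IsClosed Z ∧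
          Z ≠ Set.univ ∧ ∃ N : ℕ, 1 ≤ N ∧ N • Res[X, Z, 2 * p] (z - ℓ • w) = 0 :=
  fun _ _ hp hX ↦ ⟨2, 1, Nat.prime_two, le_rfl, fun z hz hD ↦
    stub_levelCleanOnHodgeOfHodgeConjectureFor (by omega) hX (hHC hX) 2 1 z hz hD⟩

/-- **Modulo `TorsionDiesGenerically`, `HC ⟺ C1 ∧ HeartHdg`.** Granted the route's support item
`TorsionDiesGenerically` (Colliot-Thélène–Voisin 2012 Thm. 3.1), the Hodge conjecture is equivalent to the
conjunction of the crux C1 (`HodgeClassesGenericallyDivisible`) and the Hodge-restricted heart of line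
`finite-level-bootstrap`: forward, C1 by seat 0's record
`genericDivisibility_hodgeConjecture_iff_of_torsionDiesGenerically` and HeartHdg by the previous
theorem; backward, `HeartHdg ⟹ C2_Hdg` and `C1 ∧ C2_Hdg ⟹ HC`
(`genericDivisibility_hodgeConjecture_of_hodgeBounded`, Thomas 2005 Thm. 1 road). So, restricted to
classes Hodge modulo coniveau one, the heart is EXACTLY HC-hard; its Hodge-free surplus is the non-Hodge
phantom question. CONDITIONAL on the named support item only through the forward implication to C1.
[cite: ColliotTheleneVoisin2012, §3 Thm. 3.1] [cite: Thomas2005Nodes, Thm. 1] -/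
theorem genericDivisibilityBounded_hodgeConjecture_iff_C1_and_heartHdg (hT : TorsionDiesGenerically) :
    _root_.HodgeConjecture ↔
      (HodgeClassesGenericallyDivisible ∧
        ∀ ⦃p : ℕ⦄ ⦃X : SchemeOver ℂ⦄, 2 ≤ p → IsSmoothProjective (2 * p) X →
          ∃ ℓ s : ℕ, ℓ.Prime ∧ 1 ≤ s ∧ ∀ z : singularCohomology ℤ ℤ (ComplexPoints X) (2 * p),
            (∃ h : complexBetti X (2 * p), IsRationalClass h ∧ IsOfHodgeType (2 * p) X (2 * p) p p h ∧
              singularCohomology.ringChange (Int.castRingHom ℂ) (ComplexPoints X) (2 * p) z - h ∈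
                supportedClasses X (2 * p) 1) →
            (∃ Z : Set X.left, IsClosed Z ∧ Z ≠ Set.univ ∧
              ∃ (y : singularCohomology ℤ ℤ (complexPointsCompl X Z) (2 * p)) (M : ℕ), 1 ≤ M ∧
                M • (Res[X, Z, 2 * p] z - ℓ ^ s • y) = 0) →
            ∃ w : singularCohomology ℤ ℤ (ComplexPoints X) (2 * p), ∃ Z : Set X.left, IsClosed Z ∧
              Z ≠ Set.univ ∧ ∃ N : ℕ, 1 ≤ N ∧ N • Res[X, Z, 2 * p] (z - ℓ • w) = 0) :=
  ⟨fun hHC ↦ ⟨((genericDivisibility_hodgeConjecture_iff_of_torsionDiesGenerically hT).1 hHC).1,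
      genericDivisibilityBounded_heartHdg_of_hodgeConjecture hHC⟩,
    fun h ↦ genericDivisibility_hodgeConjecture_of_hodgeBounded h.1
      (genericDivisibilityBounded_hodgeBounded_of_heartHdg h.2)⟩

/-- **Registered sub-goal `stub_hodgeConjectureIffC1AndHeartHdg` of stmt-HodgeConjecture-18467 (lead c5,
line `finite-level-bootstrap`)**: the previous theorem, in the registered (notation-free) spelling.
[cite: ColliotTheleneVoisin2012, §3 Thm. 3.1] [cite: Thomas2005Nodes, Thm. 1] -/
theorem stub_hodgeConjectureIffC1AndHeartHdg :
    TorsionDiesGenerically → (_root_.HodgeConjecture ↔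
      (HodgeClassesGenericallyDivisible ∧
        ∀ ⦃p : ℕ⦄ ⦃X : SchemeOver ℂ⦄, 2 ≤ p → IsSmoothProjective (2 * p) X →
          ∃ ℓ s : ℕ, ℓ.Prime ∧ 1 ≤ s ∧ ∀ z : singularCohomology ℤ ℤ (ComplexPoints X) (2 * p),
            (∃ h : complexBetti X (2 * p), IsRationalClass h ∧ IsOfHodgeType (2 * p) X (2 * p) p p h ∧
              singularCohomology.ringChange (Int.castRingHom ℂ) (ComplexPoints X) (2 * p) z - h ∈
                supportedClasses X (2 * p) 1) →
            (∃ Z : Set X.left, IsClosed Z ∧ Z ≠ Set.univ ∧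
              ∃ (y : singularCohomology ℤ ℤ (complexPointsCompl X Z) (2 * p)) (M : ℕ), 1 ≤ M ∧
                M • (singularCohomology.map ℤ ℤ
                  (⟨Subtype.val, continuous_subtype_val⟩ : C(complexPointsCompl X Z, ComplexPoints X))
                  (2 * p) z - ℓ ^ s • y) = 0) →
            ∃ w : singularCohomology ℤ ℤ (ComplexPoints X) (2 * p),
              ∃ Z : Set X.left, IsClosed Z ∧ Z ≠ Set.univ ∧ ∃ N : ℕ, 1 ≤ N ∧
                N • singularCohomology.map ℤ ℤ
                  (⟨Subtype.val, continuous_subtype_val⟩ : C(complexPointsCompl X Z, ComplexPoints X))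
                  (2 * p) (z - ℓ • w) = 0)) :=
  fun hT ↦ genericDivisibilityBounded_hodgeConjecture_iff_C1_and_heartHdg hT

end Summit.HodgeConjecture.HodgeConjecture.Theorems

end
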